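import Summits.ABC.IUTFork.LDHGenuinePoint
import Literature.IUT.LogVolume.MultiradialRegionSlotBound
import Literature.IUT.LogVolume.PilotSlotResidueBounds
import HarnessLib

/-!
# The fork at [IUTchIII] Corollary 3.12, L-DH level: the (Ind1) SLOT RESIDUE is a lower bound for every
# hull-volume estimate — Dupuy–Hilado data, genuine Θ-volume inputs, and the `λ`-line (child (ii′) of the
# layer-2 cut of crux `ThetaPartII`)

Record-only PROOF file (D-0012) of the abc-iut cell (campaign-S seat abc-iut-S8); TAKES NO SIDE. Sources:
Dupuy–Hilado, arXiv:2004.13228 [DupuyHilado2025] §3.3, §3.6, §3.9, Thm. 3.10.1, §4.7 ((Ind1) = permutations of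
the tensor factors), §4.10–4.12 (`U_Θ = Ind2(Ind1((O_𝕃(−P_Θ))^{Ind3}))`, `hull`, (1.1)); S. Mochizuki, *IUT IV*
[Mochizuki2012], proof of Thm. 1.10 Step (v) p. 27–28 ("`i†` to be `j`"; "after symmetrizing with respect to the
choice of "`i† ∈ I`" … after passing to weighted averages, the operation of symmetrizing … does not affect the
computation of the upper bound"); the cell's audit note HOME/plan/c312/STEPV-IND1-NOTE.md (abc-iut-c312-d1) and
its per-summand kernel form `MultiradialRegionInd1Bound` (p406699).

WHAT IS PROVED. With `PilotData.slotResidue X T ≥ 0` the purely combinatorial residue of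
`PilotSlotResidue.lean` (weighted/procession average over collections `v⃗` of `θ_j(v⃗(j)) − min_k θ_j(v⃗(k))`,
`θ_j(v) = P_{Θ,j}(v)·ln|κ(v)|/n_v`; zero iff-ish slot-constant, e.g. `F_mod = ℚ`):
* `DHData.neg_ndegLgpSlotMin_le_negLogThetaDH` — for EVERY Dupuy–Hilado datum `D` (any model, any (Ind3)-datum):
  `−ndegLgpSlotMin(P_Θ) ≤ ln ν̄_𝕃(hull(U_Θ))` (the global form of c312-d1's per-summand lower bound,
  `MultiradialRegionSlotBound`), next to Thm. 3.10.1's `ln ν̄_𝕃(O_𝕃(−P_Θ)) = −deĝ̲_lgp(P_Θ)`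
  (`DHData.ndegLgpOn_eq_ndegLgp`);
* `DHData.slotResidue_le_of_estimateDH` — hence `EstimateDH δ → slotResidue ≤ δ`: no hull-volume estimate of
  the shape of [IUTchIV] Steps (v)–(viii) can have discrepancy below the slot residue;
* `DHData.slotResidue_le_of_hullEstimateOf` / `slotResidue_le_explicitDelta` — the same for abc-iut-S2's GENUINE
  Θ-volume inputs `I` (`I.HullEstimateOf δ → slotResidue I.X I.supportPrimes ≤ δ`, through `estimateDH_ofInput_iff`),
  in particular abc-iut-c312-d1's explicit constant `δΣ(I) = explicitDelta I` dominates the residue: its slot term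
  is SHARP, not an artefact of the estimate;
* `PointDict.slotResidue_le_of_hullVolumeAtDatum` — at the `λ`-line: `Cor22.HullVolumeAtDatum P l δ` (the
  conclusion of the registered child (ii′) `stub_hullVolume` of stmt-ABC-19678, there with the printed bound
  `δ = B(P,l)` of [IUTchIV] Thm. 1.10) forces `slotResidue ≤ δ` for EVERY genuine datum at `(P, l)`.
READING (for the planners; nothing asserted): child (ii′) is print's Steps (iv)–(viii) claim for every genuine
datum; by the theorems below it also asserts the ARITHMETIC inequality `slotResidue(T) ≤ B(P,l)` on the pilot
divisors of every datum `T` at `(P,l)` — vacuous at `d_mod = 1`/slot-constant data (`slotResidue = 0`), a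
genuine extra condition at `d_mod > 1` with a bad prime split in `F_mod` (STEPV-IND1-NOTE §4). Whether such data
exist at admissible `(P,l)` is child (i) (`ThetaDataExistsAt`); this file does not construct any datum.
[cite: DupuyHilado2025, §4.7, §4.10–4.12] [cite: Mochizuki2012, IUTchIV Thm. 1.10 Step (v) p. 27–28]
[claim: Mochizuki2012, status: disputed] for every IUT quotation. No side taken on [IUTchIII] Cor. 3.12.
-/

noncomputable section

namespace Summit.ABC.IUTFork

open Literature.IUT.LogVolume NumberField IsDedekindDomain

namespace DHData

section DH

variable {F : Type} [Field F] [NumberField F] (D : DHData F)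

/-- The bookkeeping identity: for the theta-idele of a DH datum, `ln|t_{Θ,j,v}|_p = −θ_j(v)` with
`θ_j(v) = P_{Θ,j}(v)·ln|κ(v)|/n_v = PilotData.slotValue` (Dupuy–Hilado (3.4) and `tΘ_ord`).
[cite: DupuyHilado2025, §3.4, §3.9] -/
theorem lnAbs_tΘ_eq_neg_slotValue (i : Fin D.X.lstar) (p : ℕ) (v : placesOver F p) :
    D.M.lnAbs (D.tΘ i p v) = -D.X.slotValue i v.1 := by
  rw [PacketModel.lnAbs, D.tΘ_ord, PilotData.slotValue, neg_div]

/-- **The hull of `U_Θ` is bounded below by the least-slot aggregate, for every DH datum**: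
`−ndegLgpSlotMin(P_Θ; T) ≤ ln ν̄_𝕃(hull(U_Θ)) = negLogThetaDH D` (hull components admissible by `D.hull_adm`;
per summand: c312-d1's `lnAbs_le_logμ_hullUTheta_of_slot`). [cite: DupuyHilado2025, §4.7, §4.11, §4.12] -/
theorem neg_ndegLgpSlotMin_le_negLogThetaDH : -D.X.ndegLgpSlotMin D.T ≤ D.negLogThetaDH :=
  D.M.neg_slotMin_le_lnνL_hullUTheta D.ind3 (fun i _ v => D.X.slotValue i v.1)
    (D.lnAbs_tΘ_eq_neg_slotValue) D.hull_adm D.T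

/-- **The last-slot aggregate IS `deĝ̲_lgp(P_Θ)`** for a DH datum (`T` contains the residue characteristics of
`S`): `ndegLgpOn X T = deĝ̲_lgp(P_Θ)` — Thm. 3.10.1 (`lnνL_regionΘ`) read through the bookkeeping `θ`.
[cite: DupuyHilado2025, Thm. 3.10.1] -/
theorem ndegLgpOn_eq_ndegLgp : D.X.ndegLgpOn D.T = LgpDivisor.ndegLgp D.X.thetaPilot := by
  have h1 := D.lnνL_regionΘ
  rw [D.M.lnνL_region_eq_neg_lastSlot (fun i _ v => D.X.slotValue i v.1) (D.lnAbs_tΘ_eq_neg_slotValue) D.T]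
    at h1
  have h2 : D.X.ndegLgpOn D.T = ∑ p ∈ D.T, (1 / (D.X.lstar : ℝ)) * ∑ i : Fin D.X.lstar,
      ∑ e : Fin ((i : ℕ) + 1 + 1) → placesOver F p,
        D.X.slotValue i (e (Fin.last _)).1 * ∏ k, weight F (e k).1 := rfl
  linarith

/-- **The slot residue of a DH datum in volume terms**: `slotResidue = deĝ̲_lgp(P_Θ) − ndegLgpSlotMin`, i.e.
`−ndegLgpSlotMin = −deĝ̲_lgp(P_Θ) + slotResidue = ln ν̄_𝕃(O_𝕃(−P_Θ)) + slotResidue`.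
[cite: DupuyHilado2025, Thm. 3.10.1, §4.7] -/
theorem slotResidue_eq : D.X.slotResidue D.T = LgpDivisor.ndegLgp D.X.thetaPilot - D.X.ndegLgpSlotMin D.T := by
  rw [PilotData.slotResidue, ndegLgpOn_eq_ndegLgp]

/-- **`ln ν̄_𝕃(O_𝕃(−P_Θ)) + slotResidue ≤ ln ν̄_𝕃(hull(U_Θ))`** — the free inequality SHARPENED by the residue:
the hull of the union of the (Ind1)-permuted images exceeds the bare region by at least the slot residue.
[cite: DupuyHilado2025, §4.7, §4.10–4.12] -/
theorem lnνL_region_add_slotResidue_le_negLogThetaDH :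
    D.M.lnνL D.X.lstar D.T (D.M.region D.tΘ) + D.X.slotResidue D.T ≤ D.negLogThetaDH := by
  rw [D.lnνL_regionΘ, slotResidue_eq]
  have := D.neg_ndegLgpSlotMin_le_negLogThetaDH
  linarith

/-- **Every DH hull-volume estimate dominates the slot residue**: `EstimateDH δ → slotResidue ≤ δ`
(`EstimateDH δ` = "`ln ν̄_𝕃(hull(U_Θ)) ≤ ln ν̄_𝕃(O_𝕃(−P_Θ)) + δ`", the shape of [IUTchIV] Thm. 1.10 Steps
(v)–(viii)). In particular any such `δ` is `≥ 0` AND `≥` the (Ind1) defect of the pilot data.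
[cite: Mochizuki2012, IUTchIV Thm. 1.10 Step (v) p. 27–28] -/
theorem slotResidue_le_of_estimateDH {δ : ℝ} (h : D.EstimateDH δ) : D.X.slotResidue D.T ≤ δ := by
  unfold EstimateDH at h
  have := D.lnνL_region_add_slotResidue_le_negLogThetaDH
  linarith

/-- **Quantitative form at a split prime (DH level)**: if `EstimateDH δ`, then for every prime `p ∈ T` and places
`v, v'` of `F` over `p`, `w_v·w_{v'}·((ℓ⋇+1)(2ℓ⋇+1)/6)·(μ(v) − μ(v')) ≤ δ` with `μ(u) = P_q(u)·ln|κ(u)|/n_u`,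
`w_u = n_u/[F:ℚ]` (`PilotSlotResidueBounds.slotResidue_ge_pair_closed`): a bad place `v` and a good place `v'`
over the same `p` force `δ ≥ w_v·w_{v'}·((ℓ⋇+1)(2ℓ⋇+1)/6)·μ(v) > 0` (STEPV-IND1-NOTE §4).
[cite: Mochizuki2012, IUTchIV Thm. 1.10 Step (v) p. 27–28] -/
theorem pair_le_of_estimateDH {δ : ℝ} (h : D.EstimateDH δ) {p : ℕ} [Fact p.Prime] (hp : p ∈ D.T)
    (v v' : placesOver F p) :
    weight F v.1 * weight F v'.1 * (((D.X.lstar : ℝ) + 1) * (2 * D.X.lstar + 1) / 6) *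
        (D.X.qPilot v.1 * logNorm F v.1 / (localDegree F v.1 : ℝ)
          - D.X.qPilot v'.1 * logNorm F v'.1 / (localDegree F v'.1 : ℝ)) ≤ δ :=
  (D.X.slotResidue_ge_pair_closed D.T hp v v').trans (D.slotResidue_le_of_estimateDH h)

end DH

/-! ## Genuine Θ-volume inputs (abc-iut-S2's `ThetaVolumeInput`) -/

section Input

variable {F₀ : Type} [Field F₀] [NumberField F₀] {K : Type} [Field K] [NumberField K] [Algebra F₀ K]
variable (I : ThetaVolumeInput F₀ K)

/-- **For every genuine Θ-volume input**: `HullEstimateOf I δ → slotResidue(P_Θ; T(I)) ≤ δ` — the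
computable half of [IUTchIV] Thm. 1.10, in whatever form it is proved for the DEFINED `−|log(Θ)|` of the input
(`negLogThetaNonarch I`, hull of the union over the factor permutations and the (Ind2)-groups, Mochizuki's shell
normalisation), carries a discrepancy at least the (Ind1) slot residue of the input's pilot data
(through abc-iut-S2's `estimateDH_ofInput_iff`). [cite: Mochizuki2012, IUTchIV Thm. 1.10 Step (v) p. 27–28] -/
theorem slotResidue_le_of_hullEstimateOf {δ : ℝ} (h : I.HullEstimateOf δ) :
    I.X.slotResidue I.supportPrimes ≤ δ :=
  (ofInput I).slotResidue_le_of_estimateDH ((estimateDH_ofInput_iff I δ).mpr h)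

/-- **abc-iut-c312-d1's explicit constant dominates the residue**: `slotResidue(P_Θ; T(I)) ≤ δΣ(I) =
explicitDelta I` for every genuine input — the slot term that `explicitDelta` carries
(`{θ(v_j) − min_a θ(v_a)}`, [IUTchIV] Step (v) read with `λ_min`) is FORCED, not an artefact of the estimate:
no constant without it can satisfy `HullEstimateOf`. [cite: Mochizuki2012, IUTchIV Thm. 1.10 Step (v) p. 27–28] -/
theorem slotResidue_le_explicitDelta : I.X.slotResidue I.supportPrimes ≤ explicitDelta I :=
  slotResidue_le_of_hullEstimateOf I (hullEstimateOf_ofInput I)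

/-- The free inequality for the input SHARPENED by the residue:
`−deĝ̲_lgp(P_Θ) + slotResidue ≤ negLogThetaNonarch I`. [cite: DupuyHilado2025, §4.7, §4.10–4.12] -/
theorem neg_ndegLgp_add_slotResidue_le_negLogThetaNonarch :
    -LgpDivisor.ndegLgp I.X.thetaPilot + I.X.slotResidue I.supportPrimes ≤ I.negLogThetaNonarch := by
  have h := (ofInput I).lnνL_region_add_slotResidue_le_negLogThetaDH
  rw [negLogThetaDH_ofInput, lnνL_regionΘ] at h
  exact h

/-- **Quantitative form at a split prime (genuine input)**: `HullEstimateOf I δ` forces, for every prime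
`p ∈ T(I)` and places `v, v'` of `F_mod` over `p`, `w_v·w_{v'}·((ℓ⋇+1)(2ℓ⋇+1)/6)·(μ(v) − μ(v')) ≤ δ` — e.g. for the
residue characteristic `p` of a bad place `v ∈ S` (`p ∈ T(I)` by `residueChar_mem_supportPrimes`) and a good place
`v'` over the same `p`. [cite: Mochizuki2012, IUTchIV Thm. 1.10 Step (v) p. 27–28] -/
theorem pair_le_of_hullEstimateOf {δ : ℝ} (h : I.HullEstimateOf δ) {p : ℕ} [Fact p.Prime]
    (hp : p ∈ I.supportPrimes) (v v' : placesOver F₀ p) :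
    weight F₀ v.1 * weight F₀ v'.1 * (((I.X.lstar : ℝ) + 1) * (2 * I.X.lstar + 1) / 6) *
        (I.X.qPilot v.1 * logNorm F₀ v.1 / (localDegree F₀ v.1 : ℝ)
          - I.X.qPilot v'.1 * logNorm F₀ v'.1 / (localDegree F₀ v'.1 : ℝ)) ≤ δ :=
  (I.X.slotResidue_ge_pair_closed I.supportPrimes hp v v').trans (slotResidue_le_of_hullEstimateOf I h)

end Input

end DHData

/-! ## At the `λ`-line: what child (ii′) `HullVolumeAtDatum P l B(P,l)` asserts beyond print -/

namespace PointDict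

open Literature.NumberTheory.DiophantineGeometry.GenEll

variable {P : NFPoint} {l : ℕ}

/-- **`Cor22.HullVolumeAtDatum P l δ` forces `slotResidue ≤ δ` at every genuine datum of `(P, l)`.** The
registered child (ii′) of the layer-2 cut of crux `ThetaPartII` (stmt-ABC-19678) concludes
`HullVolumeAtDatum P l B(P,l)` with the PRINTED bound `B(P,l)` of [IUTchIV] Thm. 1.10 (Steps (ii)(iii)(v)
substituted); by this theorem it thereby asserts, for every genuine Θ-volume datum `T` at `(P,l)`, the
arithmetic inequality `slotResidue(T) ≤ B(P,l)` on the pilot divisors of `T` over `F_mod = ℚ(j(λ))` — trivial when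
`F_mod` has one place over each support prime (`PilotData.slotResidue_eq_zero_of_card_le_one`, e.g. `d_mod = 1`),
a genuine extra condition otherwise (STEPV-IND1-NOTE §4). Nothing asserted about the existence of data.
[claim: Mochizuki2012, status: disputed] -/
theorem slotResidue_le_of_hullVolumeAtDatum {δ : ℝ} (h : Cor22.HullVolumeAtDatum P l δ)
    (T : Cor22.ThetaVolumeDatumAt P l) :
    (letI := T.instFieldF; letI := T.instNumberFieldF; letI := T.instFieldK; letI := T.instNumberFieldK
     letI := T.instAlgebraK
     T.I.X.slotResidue T.I.supportPrimes) ≤ δ := by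
  letI := T.instFieldF; letI := T.instNumberFieldF; letI := T.instFieldK; letI := T.instNumberFieldK
  letI := T.instAlgebraK
  exact DHData.slotResidue_le_of_hullEstimateOf T.I (h T)

/-- **The point squeeze modulo [IUTchIII] Cor. 3.12, residue made visible**: `Cor22.Cor312AtDatum P l`
(HYPOTHESIS — disputed) and `HullVolumeAtDatum P l δ` give, for every genuine datum `T` with `λ ∈ U_X`,
`((l+1)/24 − 1/(2l))·log(q^{∤{2,l}}(λ)) ≤ δ + ((l+5)/4)·log π` (abc-iut-S2) AND `slotResidue(T) ≤ δ`: the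
discrepancy that enters the Diophantine inequality is at least the (Ind1) defect of the datum.
[claim: Mochizuki2012, status: disputed] -/
theorem logQAvoid_le_and_slotResidue_le {δ : ℝ} (h1 : Cor22.Cor312AtDatum P l)
    (h2 : Cor22.HullVolumeAtDatum P l δ) (T : Cor22.ThetaVolumeDatumAt P l) (hU : P.InU) :
    (((l : ℝ) + 1) / 24 - 1 / (2 * l)) * Cor22.logQAvoid P {2, l} ≤ δ + ThetaVolumeInput.archLogTheta l ∧
      (letI := T.instFieldF; letI := T.instNumberFieldF; letI := T.instFieldK; letI := T.instNumberFieldK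
       letI := T.instAlgebraK
       T.I.X.slotResidue T.I.supportPrimes) ≤ δ :=
  ⟨logQAvoid_le_of_cor312AtDatum h1 h2 T hU, slotResidue_le_of_hullVolumeAtDatum h2 T⟩

end PointDict

end Summit.ABC.IUTFork

end
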